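import Mathlib
import Literature.Analysis.FluidPDE.VectorCalculus

/-!
# Stub `stub_curlOfDegreeZeroField` of the line `Sketch`
# (crux `DyadicWallCascade.HalfSpaceHierarchy`, stmt-AnomalousDissipation-18627)

Sorry-free discharge of the registered tool stub `stub_curlOfDegreeZeroField` of the lead's skeleton
(`Cruxes/HalfSpaceHierarchy/Lines/Sketch.lean`): the first lemma of the idea card `octave-transfer-rpf`
("the vorticity of a degree-`0` field has degree `−1`").

**Statement.**  Let `V : ℝ³ → ℝ³` be differentiable at every point of the open upper half-space
`H = {X | 0 < X 2}` and invariant under the dilation `X ↦ 2X` there (`V (2 • X) = V X` for `X ∈ H`).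
Then `curl V (2 • X) = ½ • curl V X` for every `X ∈ H` (`curl = Literature.Analysis.FluidPDE.curl`).

**Proof.**  Pure chain rule.  `H` is open (the coordinate `X ↦ X 2` is continuous) and stable under
`X ↦ 2X`, so `V` agrees with `V ∘ (2 • ·)` on a neighbourhood of `X ∈ H`; hence
`DV(X) = D(V ∘ (2 • ·))(X) = DV(2X) ∘ (2 • id) = 2 • DV(2X)` (`Filter.EventuallyEq.fderiv_eq`,
`HasFDerivAt.comp`, `HasFDerivAt.const_smul`), i.e. `DV(2X) = ½ • DV(X)`
(`fderiv_two_smul_of_dilationInvariant`).  The curl is linear in the Fréchet derivative, so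
unfolding `curl` componentwise gives the claim.

Source: folklore chain rule (homogeneity of derivatives of homogeneous maps); card `octave-transfer-rpf`,
§First lemma.
-/

set_option linter.dupNamespace false

noncomputable section

open scoped Topology
open Literature.Analysis.FluidPDE

namespace Summit.AnomalousDissipation.AnomalousDissipation.Theorems.HalfSpaceHierarchy

/-- The open upper half-space `{X | 0 < X 2}` of `ℝ³ = EuclideanSpace ℝ (Fin 3)` is open
(preimage of `(0, ∞)` under the continuous coordinate map `X ↦ X 2`). [folklore] -/
theorem isOpen_halfSpace_coord_two_pos :
    IsOpen {X : EuclideanSpace ℝ (Fin 3) | 0 < X 2} :=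
  isOpen_lt continuous_const (PiLp.continuous_apply 2 (fun _ : Fin 3 => ℝ) 2)

/-- **Chain rule for a dilation-invariant field.**  If `V : ℝ³ → ℝ³` is differentiable on the open
half-space `{0 < X 2}` and satisfies `V (2 • X) = V X` there, then its Fréchet derivative has degree
`−1`: `DV(2X) = ½ • DV(X)` for `0 < X 2`.  Indeed `V = V ∘ (2 • ·)` near `X`, so
`DV(X) = DV(2X) ∘ (2 • id) = 2 • DV(2X)`. [folklore] -/
theorem fderiv_two_smul_of_dilationInvariant
    (V : EuclideanSpace ℝ (Fin 3) → EuclideanSpace ℝ (Fin 3))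
    (hdiff : ∀ X : EuclideanSpace ℝ (Fin 3), 0 < X 2 → DifferentiableAt ℝ V X)
    (hinv : ∀ X : EuclideanSpace ℝ (Fin 3), 0 < X 2 → V ((2 : ℝ) • X) = V X)
    (X : EuclideanSpace ℝ (Fin 3)) (hX : 0 < X 2) :
    fderiv ℝ V ((2 : ℝ) • X) = (1 / 2 : ℝ) • fderiv ℝ V X := by
  -- `2 • X` lies in the half-space as well
  have h2X : 0 < ((2 : ℝ) • X) 2 := by
    rw [PiLp.smul_apply, smul_eq_mul]
    positivity
  -- `V` agrees with `V ∘ (2 • ·)` on a neighbourhood of `X`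
  have hEq : V =ᶠ[𝓝 X] (V ∘ fun Y : EuclideanSpace ℝ (Fin 3) => (2 : ℝ) • Y) :=
    Filter.eventuallyEq_of_mem (isOpen_halfSpace_coord_two_pos.mem_nhds hX)
      fun Y hY => (hinv Y hY).symm
  -- chain rule for the composite
  have hsmul : HasFDerivAt (fun Y : EuclideanSpace ℝ (Fin 3) => (2 : ℝ) • Y)
      ((2 : ℝ) • ContinuousLinearMap.id ℝ (EuclideanSpace ℝ (Fin 3))) X :=
    (hasFDerivAt_id X).const_smul (2 : ℝ)
  have hcomp : HasFDerivAt (V ∘ fun Y : EuclideanSpace ℝ (Fin 3) => (2 : ℝ) • Y)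
      ((fderiv ℝ V ((2 : ℝ) • X)).comp
        ((2 : ℝ) • ContinuousLinearMap.id ℝ (EuclideanSpace ℝ (Fin 3)))) X :=
    (hdiff _ h2X).hasFDerivAt.comp X hsmul
  have hderiv : fderiv ℝ V X = (2 : ℝ) • fderiv ℝ V ((2 : ℝ) • X) := by
    rw [hEq.fderiv_eq, hcomp.fderiv, ContinuousLinearMap.comp_smul, ContinuousLinearMap.comp_id]
  rw [hderiv, smul_smul]
  norm_num

/-- **Tool stub `stub_curlOfDegreeZeroField`** (card `octave-transfer-rpf`, first lemma).  A field of
degree `0` under `X ↦ 2X` on the open half-space `{0 < X 2}`, differentiable there, has vorticity of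
degree `−1`: `curl V (2X) = ½ curl V X`.  Proof: `DV(2X) = ½ • DV(X)`
(`fderiv_two_smul_of_dilationInvariant`) and `curl` is linear in `DV`. [folklore] -/
theorem stub_curlOfDegreeZeroField :
    ∀ (V : EuclideanSpace ℝ (Fin 3) → EuclideanSpace ℝ (Fin 3)),
      (∀ X : EuclideanSpace ℝ (Fin 3), 0 < X 2 → DifferentiableAt ℝ V X) →
      (∀ X : EuclideanSpace ℝ (Fin 3), 0 < X 2 → V ((2 : ℝ) • X) = V X) →
      ∀ X : EuclideanSpace ℝ (Fin 3), 0 < X 2 → curl V ((2 : ℝ) • X) = (1 / 2 : ℝ) • curl V X := by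
  intro V hdiff hinv X hX
  have hD := fderiv_two_smul_of_dilationInvariant V hdiff hinv X hX
  simp only [curl, hD]
  ext k
  fin_cases k <;>
    simp [PiLp.smul_apply, Matrix.cons_val_zero, Matrix.cons_val_one, Matrix.cons_val_two,
      Matrix.head_cons, Matrix.tail_cons] <;>
    ring

end Summit.AnomalousDissipation.AnomalousDissipation.Theorems.HalfSpaceHierarchy

end
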